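import Summits.HubbardSuperconductivity.HubbardLadder.Bounds.ThermalStiffnessCeilingCurrentMoments
import Literature.MathematicalPhysics.QuantumLattice.BogoliubovInequalityDuhamel
import HarnessLib

/-!
# Hubbard ladder — Bounds: the thermal trial-operator (Bogoliubov) stiffness ceiling,
# part 1 of 2 — the engine and the `t–t'` Hubbard torus in its canonical sectors

HONEST FRAMING (cell pub-hubbard): ladder R1–R4 with certified numbers; no claim on H/H₀. This is
a bound for a MODEL CLASS (the `t–t'` Hubbard torus `hubbardTorusTT' L 1 t' U` on `(ℤ/L)²`,
`L ≥ 3`, every `t'`, `U`, every coordinate sector, every `β > 0`), no materials claim; nothing here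
is a cited fact. Companion text: `pub-hubbard/paper/bounds.tex` Thm 5_T♯ / 6_T♯ ("thermal trial
operators"); table `pub-hubbard/pub-hubbard-bounds/BOUNDS.md` row T1k. Part 2
(`ThermalTrialOperatorStiffnessCeilingNumberConserving.lean`) is the general number-conserving
class on an arbitrary finite hopping graph.

## The point

The Kubo-curvature ceiling (`ThermalCurrentMomentStiffnessCeilingTT'`, Thm 5′/5_T) bounds every
admissible thermal stiffness coefficient by `½⟨K_p⟩ − (β/2)·Re (J_p, J_p)_Duh`, where the Duhamel
(Kubo–Mori) current susceptibility `(J_p, J_p)_Duh` is an imaginary-time integral — not an equal-time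
Gibbs moment. The **sharp (Duhamel) Bogoliubov inequality** of Dyson–Lieb–Simon (1978) §2,
`|⟨[C, J]⟩|² ≤ β · Re (J, J)_Duh · ⟨[C, [H, C]]⟩` (`bogoliubov_inequality_duhamel`), turns it into a
**β-free variational family of ceilings indexed by a Hermitian trial operator `C` on the sector
space**, in equal-time Gibbs moments only:

  `ρ_s L² ≤ ½ Re⟨K_p⟩ − μ ‖⟨C J_p − J_p C⟩‖ + (μ²/2) Re⟨C[H_p,C] − [H_p,C]C⟩`  for every `μ : ℝ`,

optimally (`μ = ‖⟨[C,J_p]⟩‖ / ⟨[C,[H_p,C]]⟩`)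
`ρ_s L² ≤ ½ Re⟨K_p⟩ − ‖⟨[C, J_p]⟩‖² / (2⟨[C,[H_p,C]]⟩)` (Lean's `x / 0 = 0` makes the degenerate
case `⟨[C,[H_p,C]]⟩ = 0`, where Bogoliubov forces `⟨[C,J_p]⟩ = 0`, read correctly). This is the
`T > 0` twin of the trial-direction (Hylleraas) family `StiffnessCeilingTrialDirection.lean`
(there `η = iμCψ₀` gives the same functional form), and for `C` a one-body gauge potential it is the
Paramekanti–Trivedi–Randeria thermal network bound at optimal amplitude (paper, Remark). The supremum
over `C` recovers `(β/2)[(J_p,J_p)_Duh − Z⁻¹Σ_{Eᵢ=Eⱼ}|J'ᵢⱼ|²wᵢ]` (paper), i.e. everything but the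
energy-diagonal (Drude-type) part of the Duhamel function, which the Falk–Bruch packaging
`ThermalCurrentMomentFalkBruchCeilingTT'` retains: the two moment relaxations are incomparable.

## What is proved here (no `sorry`, no new axioms)

* `trial_le_half_mul_of_sq_le`, `sq_div_le_half_mul_of_sq_le` — the scalar optimisation:
  `m² ≤ β b c`, `0 ≤ β, b, c, m` ⟹ `μ m − (μ²/2) c ≤ (β/2) b` (all `μ`) and `m²/(2c) ≤ (β/2) b`.
* `le_sub_trialOperator_of_le_sub_duhamel` — the ENGINE, any finite-dimensional Hermitian
  `H, J, C`, `β ≥ 0`: `ρ ≤ G − (β/2) Re (J,J)_Duh` ⟹ the two displayed ceilings and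
  `0 ≤ Re⟨[C,[H,C]]⟩`.
* `ThermalTrialOperatorStiffnessCeilingTT'` (`@[conjecture] def`, PROVED by `…_holds`): the torus
  node, from `thermalStiffnessTT'_le_kin_sub_duhamel` and the engine.

References (keys of `lean/references.bib`): DLS1978 §2 eqs. (22'), (27), (28) (sharp Bogoliubov);
ScalapinoWhiteZhang1993 §II; ParamekantiTrivediRanderia1998 §IV; HazraVermaRanderia2019 eq. (2).
-/

noncomputable section

namespace Summit.HubbardSuperconductivity.HubbardLadder.Bounds

open Matrix Finset
open Literature.MathematicalPhysics.QuantumLattice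
open Literature.MathematicalPhysics.QuantumFieldTheory
open Literature.Probability.LatticeModels
open scoped ComplexOrder ComplexConjugate

/-! ### The scalar optimisation -/

/-- `m² ≤ β b c` with `β, b, c, m ≥ 0` gives `μ m − (μ²/2) c ≤ (β/2) b` for every real `μ`
(for `c > 0`: `2c(μm − μ²c/2) = m² − (m − μc)² ≤ β b c`; for `c = 0`: `m = 0`). -/
theorem trial_le_half_mul_of_sq_le {β b c m : ℝ} (hβ : 0 ≤ β) (hb : 0 ≤ b) (hc : 0 ≤ c)
    (hm : 0 ≤ m) (hB : m ^ 2 ≤ β * b * c) (μ : ℝ) :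
    μ * m - μ ^ 2 / 2 * c ≤ β / 2 * b := by
  rcases hc.eq_or_lt with hc0 | hcpos
  · rw [← hc0, mul_zero] at hB
    have hm0 : m = 0 := by nlinarith
    rw [hm0, ← hc0]
    nlinarith
  · have key : (μ * m - μ ^ 2 / 2 * c) * c ≤ β / 2 * b * c := by
      nlinarith [sq_nonneg (m - μ * c)]
    exact le_of_mul_le_mul_right key hcpos

/-- `m² ≤ β b c` with `β, b, c ≥ 0` gives `m²/(2c) ≤ (β/2) b` (Lean: `x / 0 = 0`). -/
theorem sq_div_le_half_mul_of_sq_le {β b c m : ℝ} (hβ : 0 ≤ β) (hb : 0 ≤ b) (hc : 0 ≤ c)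
    (hB : m ^ 2 ≤ β * b * c) :
    m ^ 2 / (2 * c) ≤ β / 2 * b := by
  rcases hc.eq_or_lt with hc0 | hcpos
  · rw [← hc0, mul_zero, div_zero]
    positivity
  · rw [div_le_iff₀ (by positivity)]
    nlinarith

/-! ### The engine: any finite-dimensional Gibbs state -/

section Engine

variable {m : Type*} [Fintype m] [DecidableEq m]

/-- **Engine (thermal trial-operator ceiling).** For Hermitian `H, J, C`, `β ≥ 0` and reals
`ρ, G` with `ρ ≤ G − (β/2) Re (J, J)_Duh` (`(J,J)_Duh = duhamel β H J J`):
(i) `ρ ≤ G − μ‖⟨CJ − JC⟩‖ + (μ²/2) Re⟨C(HC−CH) − (HC−CH)C⟩` for every `μ : ℝ`;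
(ii) `ρ ≤ G − ‖⟨CJ − JC⟩‖²/(2 Re⟨C(HC−CH) − (HC−CH)C⟩)`; (iii) `0 ≤ Re⟨C(HC−CH) − (HC−CH)C⟩`.
The input is the sharp Bogoliubov inequality `‖⟨CJ − JC⟩‖² ≤ β Re(J,J) Re⟨[C,[H,C]]⟩`.
[cite: DLS1978, §2 eqs. (22'), (27), (28)] -/
theorem le_sub_trialOperator_of_le_sub_duhamel {H J C : Matrix m m ℂ} (hH : H.IsHermitian)
    (hJ : J.IsHermitian) (hC : C.IsHermitian) {β ρ G : ℝ} (hβ : 0 ≤ β)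
    (h : ρ ≤ G - β / 2 * (duhamel β H J J).re) :
    (∀ μ : ℝ, ρ ≤ G - μ * ‖gibbsState β H (C * J - J * C)‖ +
        μ ^ 2 / 2 * (gibbsState β H (C * (H * C - C * H) - (H * C - C * H) * C)).re) ∧
      ρ ≤ G - ‖gibbsState β H (C * J - J * C)‖ ^ 2 /
        (2 * (gibbsState β H (C * (H * C - C * H) - (H * C - C * H) * C)).re) ∧
      0 ≤ (gibbsState β H (C * (H * C - C * H) - (H * C - C * H) * C)).re := by
  have hB := bogoliubov_inequality_duhamel hH hJ hC hβ
  have hb := hH.re_duhamel_self_nonneg hJ β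
  have hc := hH.re_gibbsState_doubleComm_nonneg hC hβ
  have hm : 0 ≤ ‖gibbsState β H (C * J - J * C)‖ := norm_nonneg _
  rw [mul_assoc] at hB
  rw [show β * ((duhamel β H J J).re *
      (gibbsState β H (C * (H * C - C * H) - (H * C - C * H) * C)).re) =
      β * (duhamel β H J J).re *
        (gibbsState β H (C * (H * C - C * H) - (H * C - C * H) * C)).re by ring] at hB
  refine ⟨fun μ => ?_, ?_, hc⟩
  · have := trial_le_half_mul_of_sq_le hβ hb hc hm hB μ
    linarith
  · have := sq_div_le_half_mul_of_sq_le hβ hb hc hB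
    linarith

end Engine

/-! ### The `t–t'` Hubbard torus in its canonical sectors -/

section Thermal

variable {L : ℕ} [NeZero L]

/-- **Thermal trial-operator stiffness ceiling for the `t–t'` torus** (`L ≥ 3`, every `t', U`,
`β > 0`, `θ₀ > 0`, every coordinate sector `p`, every `ρ_s : ℝ` with
`β ρ_s θ² ≤ log Z_p(0) − log Z_p(θ)` on `|θ| ≤ θ₀`, every Hermitian `C` on the sector space,
every `μ : ℝ`): with `H_p, K_p, J_p` the sector blocks of `hubbardTorusTT' L 1 t' U`,
`kinOpTT' L t'`, `curOpTT' L t'` and `⟨·⟩` the sector Gibbs state,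
`ρ_s L² ≤ Re⟨K_p⟩/2 − μ‖⟨CJ_p − J_pC⟩‖ + (μ²/2) Re⟨C[H_p,C] − [H_p,C]C⟩`,
`ρ_s L² ≤ Re⟨K_p⟩/2 − ‖⟨CJ_p − J_pC⟩‖²/(2Re⟨C[H_p,C] − [H_p,C]C⟩)`, `0 ≤ Re⟨C[H_p,C] − [H_p,C]C⟩`.
[cite: DLS1978, §2 eqs. (22'), (27), (28)] [cite: ScalapinoWhiteZhang1993, §II] -/
theorem thermalStiffnessTT'_le_kin_sub_trialOperator (hL : 3 ≤ L) (t' U : ℝ) {β ρs θ₀ : ℝ}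
    (hβ : 0 < β) (hθ₀ : 0 < θ₀) (p : Finset (Orb (FermionTorus 2 L)) → Prop)
    [Fintype {a // p a}] [DecidableEq {a // p a}]
    (hstiff : ∀ θ : ℝ, |θ| ≤ θ₀ → β * ρs * θ ^ 2 ≤
        Real.log (partitionFn β ((hubbardTorusTT'Flux L t' U 0).toBlock p p)).re -
          Real.log (partitionFn β ((hubbardTorusTT'Flux L t' U θ).toBlock p p)).re)
    {C : Matrix {a // p a} {a // p a} ℂ} (hC : C.IsHermitian) :
    (∀ μ : ℝ, ρs * (L : ℝ) ^ 2 ≤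
        (gibbsState β ((hubbardTorusTT' L 1 t' U).toBlock p p)
            ((kinOpTT' L t').toBlock p p)).re / 2 -
          μ * ‖gibbsState β ((hubbardTorusTT' L 1 t' U).toBlock p p)
            (C * (curOpTT' L t').toBlock p p - (curOpTT' L t').toBlock p p * C)‖ +
          μ ^ 2 / 2 * (gibbsState β ((hubbardTorusTT' L 1 t' U).toBlock p p)
            (C * ((hubbardTorusTT' L 1 t' U).toBlock p p * C -
                C * (hubbardTorusTT' L 1 t' U).toBlock p p) -
              ((hubbardTorusTT' L 1 t' U).toBlock p p * C -
                C * (hubbardTorusTT' L 1 t' U).toBlock p p) * C)).re) ∧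
      ρs * (L : ℝ) ^ 2 ≤
        (gibbsState β ((hubbardTorusTT' L 1 t' U).toBlock p p)
            ((kinOpTT' L t').toBlock p p)).re / 2 -
          ‖gibbsState β ((hubbardTorusTT' L 1 t' U).toBlock p p)
            (C * (curOpTT' L t').toBlock p p - (curOpTT' L t').toBlock p p * C)‖ ^ 2 /
          (2 * (gibbsState β ((hubbardTorusTT' L 1 t' U).toBlock p p)
            (C * ((hubbardTorusTT' L 1 t' U).toBlock p p * C -
                C * (hubbardTorusTT' L 1 t' U).toBlock p p) -
              ((hubbardTorusTT' L 1 t' U).toBlock p p * C -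
                C * (hubbardTorusTT' L 1 t' U).toBlock p p) * C)).re) ∧
      0 ≤ (gibbsState β ((hubbardTorusTT' L 1 t' U).toBlock p p)
            (C * ((hubbardTorusTT' L 1 t' U).toBlock p p * C -
                C * (hubbardTorusTT' L 1 t' U).toBlock p p) -
              ((hubbardTorusTT' L 1 t' U).toBlock p p * C -
                C * (hubbardTorusTT' L 1 t' U).toBlock p p) * C)).re := by
  have hHp : ((hubbardTorusTT' L 1 t' U).toBlock p p).IsHermitian :=
    (hubbardTorusTT'_isHermitian L 1 t' U).submatrix _
  have hJp : ((curOpTT' L t').toBlock p p).IsHermitian :=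
    (isHermitian_curOpTT' (L := L) t').submatrix _
  obtain ⟨h1, -⟩ := thermalStiffnessTT'_le_kin_sub_duhamel hL t' U hβ hθ₀ p hstiff
  exact le_sub_trialOperator_of_le_sub_duhamel hHp hJp hC hβ.le h1


/-- **Thermal trial-operator (Bogoliubov) stiffness ceiling for the `t–t'` torus** — conjecture
node, PROVED below (`thermalTrialOperatorStiffnessCeilingTT'_holds`): for `L ≥ 3`, every `t', U`,
`0 < β`, `0 < θ₀`, every coordinate sector `p`, every `ρ_s : ℝ` with
`β ρ_s θ² ≤ log Z_p(0) − log Z_p(θ)` on `|θ| ≤ θ₀`, and every Hermitian `C` on the sector space: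
with `H_p, K_p, J_p` the sector blocks and `c(C) = Re⟨C[H_p,C] − [H_p,C]C⟩_{β,p}`,
`m(C) = ‖⟨CJ_p − J_pC⟩_{β,p}‖`: (i) `ρ_s L² ≤ Re⟨K_p⟩/2 − μ m(C) + (μ²/2) c(C)` for every
`μ : ℝ`; (ii) `ρ_s L² ≤ Re⟨K_p⟩/2 − m(C)²/(2c(C))`; (iii) `0 ≤ c(C)`. β-free, equal-time Gibbs
moments only. [cite: DLS1978, §2 eqs. (22'), (27), (28)] [cite: ScalapinoWhiteZhang1993, §II]
[cite: HazraVermaRanderia2019, eq. (2)] -/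
@[conjecture] def ThermalTrialOperatorStiffnessCeilingTT' : Prop :=
  ∀ (L : ℕ) [NeZero L], 3 ≤ L → ∀ (t' U β ρs θ₀ : ℝ), 0 < β → 0 < θ₀ →
    ∀ (p : Finset (Orb (FermionTorus 2 L)) → Prop) [Fintype {a // p a}] [DecidableEq {a // p a}],
    (∀ θ : ℝ, |θ| ≤ θ₀ → β * ρs * θ ^ 2 ≤
        Real.log (partitionFn β ((hubbardTorusTT'Flux L t' U 0).toBlock p p)).re -
          Real.log (partitionFn β ((hubbardTorusTT'Flux L t' U θ).toBlock p p)).re) →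
    ∀ (C : Matrix {a // p a} {a // p a} ℂ), C.IsHermitian →
    let Hp := (hubbardTorusTT' L 1 t' U).toBlock p p
    let Kp := (kinOpTT' L t').toBlock p p
    let Jp := (curOpTT' L t').toBlock p p
    (∀ μ : ℝ, ρs * (L : ℝ) ^ 2 ≤ (gibbsState β Hp Kp).re / 2 -
        μ * ‖gibbsState β Hp (C * Jp - Jp * C)‖ +
        μ ^ 2 / 2 * (gibbsState β Hp (C * (Hp * C - C * Hp) - (Hp * C - C * Hp) * C)).re) ∧
      ρs * (L : ℝ) ^ 2 ≤ (gibbsState β Hp Kp).re / 2 -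
        ‖gibbsState β Hp (C * Jp - Jp * C)‖ ^ 2 /
          (2 * (gibbsState β Hp (C * (Hp * C - C * Hp) - (Hp * C - C * Hp) * C)).re) ∧
      0 ≤ (gibbsState β Hp (C * (Hp * C - C * Hp) - (Hp * C - C * Hp) * C)).re


/-- Proof of the node `ThermalTrialOperatorStiffnessCeilingTT'`. -/
theorem thermalTrialOperatorStiffnessCeilingTT'_holds :
    ThermalTrialOperatorStiffnessCeilingTT' := by
  intro L _ hL t' U β ρs θ₀ hβ hθ₀ p _ _ hstiff C hC Hp Kp Jp
  exact thermalStiffnessTT'_le_kin_sub_trialOperator hL t' U hβ hθ₀ p hstiff hC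


end Thermal

end Summit.HubbardSuperconductivity.HubbardLadder.Bounds
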